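import Literature.Barriers.AtomisticToContinuum.AnticontinuumLocalizationBounds
import HarnessLib

/-!
# De Roeck–Huveneers 2015, §5.6 for the rotor chain, II: the pointwise bounds on `U₀`, `∂U₀`, `G₀`, `∂G₀`

`Literature/Barriers/AtomisticToContinuum/` — continuation of `AnticontinuumLocalizationBounds.lean`.
With `W = 1 + ‖ω‖`, `𝟙₁ = 𝟙_{Z₁}(ω)`, `𝟙 = 𝟙_Z(ω)` and constants `K`, `M` independent of
`ε ∈ [0,1]`, `δ ∈ (0,1]`, `q`, `ω` (W. De Roeck, F. Huveneers, CPAM 68 (2015), arXiv:1305.5127, §5.6),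
PROVED:

* `U0_bound`: `|U₀| ≤ K (𝟙₁ + ∑_{j=1}^n ε^j δ^{-2j}) W^M`;
* `dU0_bound`: `|∂_{q_y} U₀|, |∂_{ω_y} U₀| ≤ K (𝟙₁ δ^{-1} + ∑_{j=1}^n ε^j δ^{-(2j+1)}) W^M`;
* `Aterm_bound`, `Bterm_bound` and their derivatives: `|A| ≤ 𝟙 K (∑_{l=0}^n ε^l δ^{-(2l+1)}) W^M`,
  `|∂A| ≤ 𝟙 K (∑_l ε^l δ^{-(2l+2)}) W^M`, `|B| ≤ K δ^{-(2n+1)} W^M`, `|∂B| ≤ K δ^{-(2n+2)} W^M` —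
  the ingredients of the bounds on `G₀ = ε^{-(n₀+1)}(A + ε^{n+1}B)`.
-/

noncomputable section

open Function Set Finset Filter Metric
open scoped ContDiff BigOperators Topology

namespace Literature.Barriers.AtomisticToContinuum.HeatConduction.RotorChain

open Literature.MathematicalPhysics.KineticTheory.HeatConduction
open Literature.Analysis.Calculus Literature.Analysis.Calculus.IsDeltaSymbol
open Literature.Algebra.Lie Literature.Algebra.Lie.TruncSeries

variable {m : ℕ}

/-! ### Uniform sup bounds over finitely many components -/

/-- Uniform constants for `|ev S_j| ≤ C δ^{-p_j} W^M`, `j ≤ N`. [cite: DeRoeckHuveneers2015, §5.6] -/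
theorem exists_uniform_bound_ev (S : ℕ → TrigPoly m) (p : ℕ → ℕ) :
    ∀ N : ℕ, (∀ j ≤ N, (S j).InClass (p j)) → ∃ C : ℝ, ∃ M : ℕ, 0 ≤ C ∧ ∀ δ : ℝ, 0 < δ → δ ≤ 1 →
      ∀ j ≤ N, ∀ z : PhaseSpace m, |TrigPoly.ev (S j) δ z| ≤ C / δ ^ (p j) * (1 + ‖z.2‖) ^ M := by
  intro N
  induction N with
  | zero =>
    intro h
    obtain ⟨C, M, hC, hb⟩ := (h 0 le_rfl).exists_bound_ev
    exact ⟨C, M, hC, fun δ hδ hδ1 j hj z => by rw [Nat.le_zero.1 hj]; exact hb δ hδ hδ1 z⟩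
  | succ N ih =>
    intro h
    obtain ⟨C₁, M₁, hC₁, h₁⟩ := ih fun j hj => h j (Nat.le_succ_of_le hj)
    obtain ⟨C₂, M₂, hC₂, h₂⟩ := (h (N + 1) le_rfl).exists_bound_ev
    refine ⟨C₁ + C₂, max M₁ M₂, by positivity, fun δ hδ hδ1 j hj z => ?_⟩
    have hW1 := weight_pow_mono z.2 (le_max_left M₁ M₂)
    have hW2 := weight_pow_mono z.2 (le_max_right M₁ M₂)
    have hd : 0 ≤ 1 / δ ^ (p j) := by positivity
    rcases Nat.lt_or_ge j (N + 1) with hj' | hj'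
    · calc |TrigPoly.ev (S j) δ z| ≤ C₁ / δ ^ (p j) * (1 + ‖z.2‖) ^ M₁ := h₁ δ hδ hδ1 j (Nat.lt_succ_iff.1 hj') z
        _ ≤ (C₁ + C₂) / δ ^ (p j) * (1 + ‖z.2‖) ^ max M₁ M₂ := by gcongr; linarith
    · have : j = N + 1 := le_antisymm hj hj'
      subst this
      calc |TrigPoly.ev (S (N + 1)) δ z| ≤ C₂ / δ ^ (p (N + 1)) * (1 + ‖z.2‖) ^ M₂ := h₂ δ hδ hδ1 z
        _ ≤ (C₁ + C₂) / δ ^ (p (N + 1)) * (1 + ‖z.2‖) ^ max M₁ M₂ := by gcongr; linarith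

/-- Uniform constants for `|∂_q ev S_j| ≤ C δ^{-p_j} W^M` and `|∂_ω ev S_j| ≤ C δ^{-(p_j+1)} W^M`, `j ≤ N`.
[cite: DeRoeckHuveneers2015, §5.6] -/
theorem exists_uniform_bound_partial (S : ℕ → TrigPoly m) (p : ℕ → ℕ) :
    ∀ N : ℕ, (∀ j ≤ N, (S j).InClass (p j)) → ∃ C : ℝ, ∃ M : ℕ, 0 ≤ C ∧ ∀ δ : ℝ, 0 < δ → δ ≤ 1 →
      ∀ j ≤ N, ∀ (y : Fin m) (z : PhaseSpace m),
        |partialQ y (TrigPoly.ev (S j) δ) z| ≤ C / δ ^ (p j) * (1 + ‖z.2‖) ^ M ∧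
          |partialP y (TrigPoly.ev (S j) δ) z| ≤ C / δ ^ (p j + 1) * (1 + ‖z.2‖) ^ M := by
  intro N
  induction N with
  | zero =>
    intro h
    obtain ⟨B, hB⟩ := exists_modeBound (S 0)
    obtain ⟨C, M, hC, hb⟩ := (h 0 le_rfl).exists_bound_partialQ hB
    obtain ⟨C', M', hC', hb'⟩ := (h 0 le_rfl).exists_bound_partialP
    refine ⟨C + C', max M M', by positivity, fun δ hδ hδ1 j hj y z => ?_⟩
    rw [Nat.le_zero.1 hj]
    have hW1 := weight_pow_mono z.2 (le_max_left M M')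
    have hW2 := weight_pow_mono z.2 (le_max_right M M')
    constructor
    · calc |partialQ y (TrigPoly.ev (S 0) δ) z| ≤ C / δ ^ (p 0) * (1 + ‖z.2‖) ^ M := hb δ hδ hδ1 y z
        _ ≤ (C + C') / δ ^ (p 0) * (1 + ‖z.2‖) ^ max M M' := by gcongr; linarith
    · calc |partialP y (TrigPoly.ev (S 0) δ) z| ≤ C' / δ ^ (p 0 + 1) * (1 + ‖z.2‖) ^ M' := hb' δ hδ hδ1 y z
        _ ≤ (C + C') / δ ^ (p 0 + 1) * (1 + ‖z.2‖) ^ max M M' := by gcongr; linarith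
  | succ N ih =>
    intro h
    obtain ⟨C₁, M₁, hC₁, h₁⟩ := ih fun j hj => h j (Nat.le_succ_of_le hj)
    obtain ⟨B, hB⟩ := exists_modeBound (S (N + 1))
    obtain ⟨C₂, M₂, hC₂, h₂⟩ := (h (N + 1) le_rfl).exists_bound_partialQ hB
    obtain ⟨C₃, M₃, hC₃, h₃⟩ := (h (N + 1) le_rfl).exists_bound_partialP
    refine ⟨C₁ + C₂ + C₃, max M₁ (max M₂ M₃), by positivity, fun δ hδ hδ1 j hj y z => ?_⟩
    have hW1 := weight_pow_mono z.2 (le_max_left M₁ (max M₂ M₃))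
    have hW2 := weight_pow_mono z.2 ((le_max_left M₂ M₃).trans (le_max_right M₁ (max M₂ M₃)))
    have hW3 := weight_pow_mono z.2 ((le_max_right M₂ M₃).trans (le_max_right M₁ (max M₂ M₃)))
    rcases Nat.lt_or_ge j (N + 1) with hj' | hj'
    · obtain ⟨hq, hp⟩ := h₁ δ hδ hδ1 j (Nat.lt_succ_iff.1 hj') y z
      constructor
      · calc |partialQ y (TrigPoly.ev (S j) δ) z| ≤ C₁ / δ ^ (p j) * (1 + ‖z.2‖) ^ M₁ := hq
          _ ≤ (C₁ + C₂ + C₃) / δ ^ (p j) * (1 + ‖z.2‖) ^ max M₁ (max M₂ M₃) := by gcongr; linarith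
      · calc |partialP y (TrigPoly.ev (S j) δ) z| ≤ C₁ / δ ^ (p j + 1) * (1 + ‖z.2‖) ^ M₁ := hp
          _ ≤ (C₁ + C₂ + C₃) / δ ^ (p j + 1) * (1 + ‖z.2‖) ^ max M₁ (max M₂ M₃) := by gcongr; linarith
    · have : j = N + 1 := le_antisymm hj hj'
      subst this
      constructor
      · calc |partialQ y (TrigPoly.ev (S (N + 1)) δ) z| ≤ C₂ / δ ^ (p (N + 1)) * (1 + ‖z.2‖) ^ M₂ := h₂ δ hδ hδ1 y z
          _ ≤ (C₁ + C₂ + C₃) / δ ^ (p (N + 1)) * (1 + ‖z.2‖) ^ max M₁ (max M₂ M₃) := by gcongr; linarith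
      · calc |partialP y (TrigPoly.ev (S (N + 1)) δ) z| ≤ C₃ / δ ^ (p (N + 1) + 1) * (1 + ‖z.2‖) ^ M₃ := h₃ δ hδ hδ1 y z
          _ ≤ (C₁ + C₂ + C₃) / δ ^ (p (N + 1) + 1) * (1 + ‖z.2‖) ^ max M₁ (max M₂ M₃) := by gcongr; linarith

/-! ### Bounds on `U₀` -/

section UBounds

variable {r L n₂ : ℕ} {Θ : ResonanceCutoffs m r L n₂} {b : Fin m} {n₃ : ℕ} {γ : ℝ} {n : ℕ}

/-- Uniform bound for the tails `D_{>x}` (order `0`). [folklore] -/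
theorem exists_bound_tailD (m : ℕ) : ∃ C : ℝ, ∃ M : ℕ, 0 ≤ C ∧ ∀ δ : ℝ, 0 < δ → δ ≤ 1 → ∀ (x : Fin m) (z : PhaseSpace m),
    |TrigPoly.ev (tailD x) δ z| ≤ C * (1 + ‖z.2‖) ^ M ∧
      ∀ y, |partialP y (TrigPoly.ev (tailD x) δ) z| ≤ C / δ * (1 + ‖z.2‖) ^ M := by
  have hcl : ∀ x : Fin m, (tailD x).InClass 0 := fun x => (kinPoly_inClass m).filter _
  choose C M hC hb using fun x : Fin m => (hcl x).exists_bound_ev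
  choose C' M' hC' hb' using fun x : Fin m => (hcl x).exists_bound_partialP
  have hsum0 : 0 ≤ ∑ x, (C x + C' x) := Finset.sum_nonneg fun x _ => by linarith [hC x, hC' x]
  refine ⟨∑ x, (C x + C' x), Finset.univ.sup M ⊔ Finset.univ.sup M', hsum0, fun δ hδ hδ1 x z => ?_⟩
  have hCx : C x + C' x ≤ ∑ x, (C x + C' x) :=
    Finset.single_le_sum (f := fun x => C x + C' x) (fun x _ => by linarith [hC x, hC' x]) (Finset.mem_univ x)
  have hW : (1 + ‖z.2‖) ^ M x ≤ (1 + ‖z.2‖) ^ (Finset.univ.sup M ⊔ Finset.univ.sup M') :=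
    weight_pow_mono z.2 ((Finset.le_sup (f := M) (Finset.mem_univ x)).trans le_sup_left)
  have hW' : (1 + ‖z.2‖) ^ M' x ≤ (1 + ‖z.2‖) ^ (Finset.univ.sup M ⊔ Finset.univ.sup M') :=
    weight_pow_mono z.2 ((Finset.le_sup (f := M') (Finset.mem_univ x)).trans le_sup_right)
  constructor
  · have h := hb x δ hδ hδ1 z
    rw [pow_zero, div_one] at h
    exact h.trans (mul_le_mul (by linarith [hC' x]) hW (by positivity) hsum0)
  · intro y
    have h := hb' x δ hδ hδ1 y z
    rw [zero_add, pow_one] at h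
    exact h.trans (mul_le_mul (div_le_div_of_nonneg_right (by linarith [hC x]) hδ.le) hW' (by positivity) (div_nonneg hsum0 hδ.le))

/-- The coordinate vectors have sup norm `≤ 1`. [folklore] -/
theorem norm_single_le_one (y : Fin m) : ‖(Pi.single y (1 : ℝ) : Fin m → ℝ)‖ ≤ 1 := by
  refine (pi_norm_le_iff_of_nonneg zero_le_one).2 fun y' => ?_
  by_cases h : y' = y
  · subst h; simp
  · rw [Pi.single_eq_of_ne h]; simp

/-- Uniform bound for the gradients of the partition functions (order `0`). [cite: DeRoeckHuveneers2015, §5.6 ("`∂_♯ ϑ_{a,x}, ∂_♯ ϑ_{a,*} ∼ δ^{-1}`")] -/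
theorem exists_bound_vt : ∃ C : ℝ, ∃ M : ℕ, 0 ≤ C ∧ ∀ δ : ℝ, 0 < δ → δ ≤ 1 → ∀ (w : Fin m → ℝ) (y : Fin m),
    (∀ x, |fderiv ℝ (vt Θ b n₃ x δ) w (Pi.single y 1)| ≤ C / δ * (1 + ‖w‖) ^ M) ∧
      |fderiv ℝ (vtStar Θ b n₃ δ) w (Pi.single y 1)| ≤ C / δ * (1 + ‖w‖) ^ M := by
  choose C M hC hb using fun x : Fin m => (isDeltaSymbol_vt (Θ := Θ) (b := b) (n₃ := n₃) x).norm_fderiv_apply_le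
  obtain ⟨C', M', hC', hb'⟩ := (isDeltaSymbol_vtStar (Θ := Θ) (b := b) (n₃ := n₃)).norm_fderiv_apply_le
  have hS0 : 0 ≤ ∑ x, C x + C' := by have := Finset.sum_nonneg (fun x (_ : x ∈ Finset.univ) => hC x); positivity
  refine ⟨∑ x, C x + C', Finset.univ.sup M ⊔ M', hS0, fun δ hδ hδ1 w y => ⟨fun x => ?_, ?_⟩⟩
  · have h := hb x δ hδ hδ1 w (Pi.single y 1)
    rw [zero_add, pow_one, Real.norm_eq_abs] at h
    have hW : (1 + ‖w‖) ^ M x ≤ (1 + ‖w‖) ^ (Finset.univ.sup M ⊔ M') :=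
      weight_pow_mono w ((Finset.le_sup (f := M) (Finset.mem_univ x)).trans le_sup_left)
    have hCx : C x ≤ ∑ x, C x + C' :=
      (Finset.single_le_sum (f := C) (fun x _ => hC x) (Finset.mem_univ x)).trans (le_add_of_nonneg_right hC')
    have h2 : ‖(Pi.single y (1 : ℝ) : Fin m → ℝ)‖ * (C x / δ * (1 + ‖w‖) ^ M x) ≤ 1 * (C x / δ * (1 + ‖w‖) ^ M x) :=
      mul_le_mul_of_nonneg_right (norm_single_le_one y) (by have := hC x; positivity)
    rw [one_mul] at h2
    exact (h.trans h2).trans (mul_le_mul (div_le_div_of_nonneg_right hCx hδ.le) hW (by positivity) (div_nonneg hS0 hδ.le))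
  · have h := hb' δ hδ hδ1 w (Pi.single y 1)
    rw [zero_add, pow_one, Real.norm_eq_abs] at h
    have hW : (1 + ‖w‖) ^ M' ≤ (1 + ‖w‖) ^ (Finset.univ.sup M ⊔ M') := weight_pow_mono w le_sup_right
    have hCx : C' ≤ ∑ x, C x + C' := le_add_of_nonneg_left (Finset.sum_nonneg fun x _ => hC x)
    have h2 : ‖(Pi.single y (1 : ℝ) : Fin m → ℝ)‖ * (C' / δ * (1 + ‖w‖) ^ M') ≤ 1 * (C' / δ * (1 + ‖w‖) ^ M') :=
      mul_le_mul_of_nonneg_right (norm_single_le_one y) (by positivity)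
    rw [one_mul] at h2
    exact (h.trans h2).trans (mul_le_mul (div_le_div_of_nonneg_right hCx hδ.le) hW (by positivity) (div_nonneg hS0 hδ.le))

/-- The scale sums `∑_{j=1}^n ε^j δ^{-(2j+c)}` dominate `ε δ^{-(2+c)} ≥ ε` (`n ≥ 1`). [folklore] -/
theorem eps_le_scaleSum {n : ℕ} (hn : 1 ≤ n) {ε δ : ℝ} (hε : 0 ≤ ε) (hδ : 0 < δ) (hδ1 : δ ≤ 1) (c : ℕ) :
    ε ≤ ∑ j ∈ Finset.Ico 1 (n + 1), ε ^ j / δ ^ (2 * j + c) := by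
  have h1 : ε ≤ ε ^ 1 / δ ^ (2 * 1 + c) := by
    rw [pow_one, le_div_iff₀ (by positivity)]
    exact mul_le_of_le_one_right hε (pow_le_one₀ hδ.le hδ1)
  refine h1.trans (Finset.single_le_sum (f := fun j => ε ^ j / δ ^ (2 * j + c)) (fun j _ => by positivity) ?_)
  rw [Finset.mem_Ico]; omega

/-- The scale sums are nonnegative. [folklore] -/
theorem scaleSum_nonneg (s : Finset ℕ) {ε δ : ℝ} (hε : 0 ≤ ε) (hδ : 0 < δ) (f : ℕ → ℕ) :
    0 ≤ ∑ j ∈ s, ε ^ j / δ ^ (f j) := Finset.sum_nonneg fun j _ => by positivity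

/-- **Bound on `U₀`**: `|U₀| ≤ K (𝟙_{Z₁}(ω) + ∑_{j=1}^n ε^j δ^{-2j}) W^M`. [cite: DeRoeckHuveneers2015, §5.6 ("`(H^O_{>a} - H_{>a})^{(0)} = χ_W · (H^O_{>a} - H_{>a})^{(0)}`" and "`H^O_{>a} - H_{>a} ∼ ∑_{n=0}^{n₁} ε^n δ^{-2n}`")] -/
theorem U0_bound (hn : 1 ≤ n) : ∃ K : ℝ, ∃ M : ℕ, 0 ≤ K ∧ ∀ δ : ℝ, 0 < δ → δ ≤ 1 → ∀ ε : ℝ, 0 ≤ ε → ε ≤ 1 →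
    ∀ {R₁ : ℕ}, n₃ + Θ.RS ≤ R₁ → ∀ z : PhaseSpace m,
      |U0 Θ b n₃ γ n ε δ z| ≤ K * ((Z1set m r b R₁ ((L : ℝ) ^ (n₂ + 1) * δ)).indicator (fun _ => (1 : ℝ)) z.2 +
        ∑ j ∈ Finset.Ico 1 (n + 1), ε ^ j / δ ^ (2 * j)) * (1 + ‖z.2‖) ^ M := by
  obtain ⟨CD, MD, hCD, hD⟩ := exists_bound_tailD m
  obtain ⟨CV, MV, hCV, hV⟩ := ((potPoly_inClass m γ).filter (fun t => decide (b < t.pos))).exists_bound_ev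
  obtain ⟨CR, MR, hCR, hR⟩ := exists_uniform_bound_ev (RhgtSym Θ b n₃ γ n) (fun j => 2 * j) n RhgtSym_inClass
  set Mx : ℕ := MD ⊔ MV ⊔ MR with hMx
  set Kx : ℝ := (2 + (nearSites b n₃).card) * CD + CV + CR with hKx
  refine ⟨Kx, Mx, by positivity, fun δ hδ hδ1 ε hε hε1 R₁ hR₁ z => ?_⟩
  set W : ℝ := 1 + ‖z.2‖ with hW
  set χ : ℝ := (Z1set m r b R₁ ((L : ℝ) ^ (n₂ + 1) * δ)).indicator (fun _ => (1 : ℝ)) z.2 with hχ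
  set S : ℝ := ∑ j ∈ Finset.Ico 1 (n + 1), ε ^ j / δ ^ (2 * j) with hS
  have hW1 : 1 ≤ W := one_le_weight z.2
  have hWD : W ^ MD ≤ W ^ Mx := pow_le_pow_right₀ hW1 (le_sup_left.trans le_sup_left)
  have hWV : W ^ MV ≤ W ^ Mx := pow_le_pow_right₀ hW1 (le_sup_right.trans le_sup_left)
  have hWR : W ^ MR ≤ W ^ Mx := pow_le_pow_right₀ hW1 le_sup_right
  have hWx : 0 ≤ W ^ Mx := by positivity
  have hS0 : 0 ≤ S := scaleSum_nonneg _ hε hδ _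
  have hεS : ε ≤ S := by simpa using eps_le_scaleSum hn hε hδ hδ1 0
  have hχ0 : 0 ≤ χ := Set.indicator_nonneg (fun _ _ => zero_le_one) _
  -- the three pieces
  have hT : ∀ x : Fin m, |TrigPoly.ev (tailD x) δ z| ≤ CD * W ^ Mx := fun x => ((hD δ hδ hδ1 x z).1).trans (by gcongr)
  have h0 : |U0zero Θ b n₃ δ z| ≤ χ * ((2 + (nearSites b n₃).card) * CD) * W ^ Mx := by
    by_cases hz : z.2 ∈ Z1set m r b R₁ ((L : ℝ) ^ (n₂ + 1) * δ)
    · have hχ1 : χ = 1 := Set.indicator_of_mem hz _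
      rw [hχ1, one_mul]
      unfold U0zero
      calc |TrigPoly.ev (tailD b) δ z - (∑ x ∈ nearSites b n₃, vt Θ b n₃ x δ z.2 * TrigPoly.ev (tailD x) δ z +
              vtStar Θ b n₃ δ z.2 * TrigPoly.ev (tailD b) δ z)|
          ≤ |TrigPoly.ev (tailD b) δ z| + |∑ x ∈ nearSites b n₃, vt Θ b n₃ x δ z.2 * TrigPoly.ev (tailD x) δ z +
              vtStar Θ b n₃ δ z.2 * TrigPoly.ev (tailD b) δ z| := abs_sub _ _
        _ ≤ |TrigPoly.ev (tailD b) δ z| + (∑ x ∈ nearSites b n₃, |vt Θ b n₃ x δ z.2 * TrigPoly.ev (tailD x) δ z| +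
              |vtStar Θ b n₃ δ z.2 * TrigPoly.ev (tailD b) δ z|) := by
            gcongr
            exact (abs_add_le _ _).trans (by gcongr; exact Finset.abs_sum_le_sum_abs _ _)
        _ ≤ CD * W ^ Mx + (∑ x ∈ nearSites b n₃, CD * W ^ Mx + CD * W ^ Mx) := by
            gcongr with x hx
            · exact hT b
            · rw [abs_mul]
              calc |vt Θ b n₃ x δ z.2| * |TrigPoly.ev (tailD x) δ z| ≤ 1 * (CD * W ^ Mx) :=
                    mul_le_mul (by rw [abs_of_nonneg (vt_nonneg x δ z.2)]; exact vt_le_one hx δ z.2) (hT x) (abs_nonneg _) zero_le_one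
                _ = CD * W ^ Mx := one_mul _
            · rw [abs_mul]
              calc |vtStar Θ b n₃ δ z.2| * |TrigPoly.ev (tailD b) δ z| ≤ 1 * (CD * W ^ Mx) :=
                    mul_le_mul (by rw [abs_of_nonneg (vtStar_nonneg δ z.2)]; exact vtStar_le_one δ z.2) (hT b) (abs_nonneg _) zero_le_one
                _ = CD * W ^ Mx := one_mul _
        _ = (2 + (nearSites b n₃).card) * CD * W ^ Mx := by rw [Finset.sum_const, nsmul_eq_mul]; ring
    · rw [U0zero_eq_zero hδ hδ1 hR₁ hz, abs_zero]; positivity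
  have h1 : |ε * TrigPoly.ev (tailV b γ) δ z| ≤ CV * S * W ^ Mx := by
    have h := hV δ hδ hδ1 z
    rw [pow_zero, div_one] at h
    rw [abs_mul, abs_of_nonneg hε]
    calc ε * |TrigPoly.ev (tailV b γ) δ z| ≤ S * (CV * W ^ Mx) := mul_le_mul hεS (h.trans (by gcongr)) (abs_nonneg _) hS0
      _ = CV * S * W ^ Mx := by ring
  have h2 : |∑ j ∈ Finset.Ico 1 (n + 1), ε ^ j * TrigPoly.ev (RhgtSym Θ b n₃ γ n j) δ z| ≤ CR * S * W ^ Mx := by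
    calc |∑ j ∈ Finset.Ico 1 (n + 1), ε ^ j * TrigPoly.ev (RhgtSym Θ b n₃ γ n j) δ z|
        ≤ ∑ j ∈ Finset.Ico 1 (n + 1), |ε ^ j * TrigPoly.ev (RhgtSym Θ b n₃ γ n j) δ z| := Finset.abs_sum_le_sum_abs _ _
      _ ≤ ∑ j ∈ Finset.Ico 1 (n + 1), ε ^ j * (CR / δ ^ (2 * j) * W ^ Mx) := by
          refine Finset.sum_le_sum fun j hj => ?_
          rw [abs_mul, abs_of_nonneg (pow_nonneg hε j)]
          have hjn : j ≤ n := by have := Finset.mem_Ico.1 hj; omega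
          exact mul_le_mul_of_nonneg_left ((hR δ hδ hδ1 j hjn z).trans (by gcongr)) (pow_nonneg hε j)
      _ = CR * S * W ^ Mx := by
          rw [hS, Finset.mul_sum, Finset.sum_mul]
          exact Finset.sum_congr rfl fun j _ => by ring
  rw [U0_decomp hδ hδ1]
  have hcard : (0 : ℝ) ≤ (nearSites b n₃).card := Nat.cast_nonneg _
  have htri : |U0zero Θ b n₃ δ z + ε * TrigPoly.ev (tailV b γ) δ z -
        ∑ j ∈ Finset.Ico 1 (n + 1), ε ^ j * TrigPoly.ev (RhgtSym Θ b n₃ γ n j) δ z|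
      ≤ |U0zero Θ b n₃ δ z| + |ε * TrigPoly.ev (tailV b γ) δ z| +
          |∑ j ∈ Finset.Ico 1 (n + 1), ε ^ j * TrigPoly.ev (RhgtSym Θ b n₃ γ n j) δ z| :=
    (abs_sub _ _).trans (by gcongr; exact abs_add_le _ _)
  refine htri.trans ?_
  have hK1 : (2 + (nearSites b n₃).card) * CD ≤ Kx := by rw [hKx]; linarith
  have hK2 : CV + CR ≤ Kx := by rw [hKx]; nlinarith
  calc |U0zero Θ b n₃ δ z| + |ε * TrigPoly.ev (tailV b γ) δ z| +
        |∑ j ∈ Finset.Ico 1 (n + 1), ε ^ j * TrigPoly.ev (RhgtSym Θ b n₃ γ n j) δ z|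
      ≤ χ * ((2 + (nearSites b n₃).card) * CD) * W ^ Mx + CV * S * W ^ Mx + CR * S * W ^ Mx := by linarith
    _ = (χ * ((2 + (nearSites b n₃).card) * CD) + (CV + CR) * S) * W ^ Mx := by ring
    _ ≤ (χ * Kx + Kx * S) * W ^ Mx := by
        gcongr
    _ = Kx * (χ + S) * W ^ Mx := by ring

end UBounds

/-! ### Derivatives: generic helpers -/

/-- `∂_{q_y}` of a finite sum of differentiable functions. [folklore] -/
theorem partialQ_finsum {ι : Type*} (s : Finset ι) {f : ι → PhaseSpace m → ℝ} (hf : ∀ i ∈ s, Differentiable ℝ (f i))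
    (y : Fin m) (z : PhaseSpace m) : partialQ y (fun z => ∑ i ∈ s, f i z) z = ∑ i ∈ s, partialQ y (f i) z := by
  classical
  induction s using Finset.induction_on with
  | empty => simp [partialQ_const]
  | insert a s ha ih =>
    have hfa := hf a (Finset.mem_insert_self a s)
    have hfs : ∀ i ∈ s, Differentiable ℝ (f i) := fun i hi => hf i (Finset.mem_insert_of_mem hi)
    simp only [Finset.sum_insert ha]
    rw [show (fun z => f a z + ∑ i ∈ s, f i z) = f a + fun z => ∑ i ∈ s, f i z from rfl,
      partialQ_add hfa (Differentiable.fun_sum fun i hi => hfs i hi), ih hfs]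

/-- `∂_{ω_y}` of a finite sum of differentiable functions. [folklore] -/
theorem partialP_finsum {ι : Type*} (s : Finset ι) {f : ι → PhaseSpace m → ℝ} (hf : ∀ i ∈ s, Differentiable ℝ (f i))
    (y : Fin m) (z : PhaseSpace m) : partialP y (fun z => ∑ i ∈ s, f i z) z = ∑ i ∈ s, partialP y (f i) z := by
  classical
  induction s using Finset.induction_on with
  | empty => simp [partialP_const]
  | insert a s ha ih =>
    have hfa := hf a (Finset.mem_insert_self a s)
    have hfs : ∀ i ∈ s, Differentiable ℝ (f i) := fun i hi => hf i (Finset.mem_insert_of_mem hi)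
    simp only [Finset.sum_insert ha]
    rw [show (fun z => f a z + ∑ i ∈ s, f i z) = f a + fun z => ∑ i ∈ s, f i z from rfl,
      partialP_add hfa (Differentiable.fun_sum fun i hi => hfs i hi), ih hfs]

/-- `∂_{q_y}` of a function vanishing near `z` is `0`. [folklore] -/
theorem partialQ_eq_zero_of_eventuallyEq {f : PhaseSpace m → ℝ} {z : PhaseSpace m} (h : f =ᶠ[𝓝 z] fun _ => 0) (y : Fin m) :
    partialQ y f z = 0 := by
  unfold partialQ
  have hc : Continuous fun t : ℝ => ((Function.update z.1 y t, z.2) : PhaseSpace m) := by fun_prop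
  have hz : ((Function.update z.1 y (z.1 y), z.2) : PhaseSpace m) = z := by simp
  have h' : (fun t => f (Function.update z.1 y t, z.2)) =ᶠ[𝓝 (z.1 y)] fun _ => 0 := by
    have := hc.continuousAt.tendsto (x := z.1 y)
    rw [hz] at this
    exact this.eventually h
  rw [h'.deriv_eq, deriv_const]

/-- `∂_{ω_y}` of a function vanishing near `z` is `0`. [folklore] -/
theorem partialP_eq_zero_of_eventuallyEq {f : PhaseSpace m → ℝ} {z : PhaseSpace m} (h : f =ᶠ[𝓝 z] fun _ => 0) (y : Fin m) :
    partialP y f z = 0 := by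
  unfold partialP
  have hc : Continuous fun t : ℝ => ((z.1, Function.update z.2 y t) : PhaseSpace m) := by fun_prop
  have hz : ((z.1, Function.update z.2 y (z.2 y)) : PhaseSpace m) = z := by simp
  have h' : (fun t => f (z.1, Function.update z.2 y t)) =ᶠ[𝓝 (z.2 y)] fun _ => 0 := by
    have := hc.continuousAt.tendsto (x := z.2 y)
    rw [hz] at this
    exact this.eventually h
  rw [h'.deriv_eq, deriv_const]

/-- Scale sums with one more inverse power dominate `ε/δ`. [folklore] -/
theorem eps_div_le_scaleSum {n : ℕ} (hn : 1 ≤ n) {ε δ : ℝ} (hε : 0 ≤ ε) (hδ : 0 < δ) (hδ1 : δ ≤ 1) :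
    ε / δ ≤ ∑ j ∈ Finset.Ico 1 (n + 1), ε ^ j / δ ^ (2 * j + 1) := by
  have h1 : ε / δ ≤ ε ^ 1 / δ ^ (2 * 1 + 1) := by
    rw [pow_one, div_le_div_iff₀ hδ (by positivity)]
    have : δ ^ (2 * 1 + 1) = δ * δ ^ 2 := by ring
    rw [this]
    have hδ2 : δ ^ 2 ≤ 1 := pow_le_one₀ hδ.le hδ1
    nlinarith [mul_nonneg hε hδ.le]
  refine h1.trans (Finset.single_le_sum (f := fun j => ε ^ j / δ ^ (2 * j + 1)) (fun j _ => by positivity) ?_)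
  rw [Finset.mem_Ico]; omega

/-- Monotonicity of inverse powers of `δ ≤ 1`. [folklore] -/
theorem div_pow_le_div_pow_succ {C δ : ℝ} (hC : 0 ≤ C) (hδ : 0 < δ) (hδ1 : δ ≤ 1) (p : ℕ) : C / δ ^ p ≤ C / δ ^ (p + 1) := by
  refine div_le_div_of_nonneg_left hC (by positivity) ?_
  rw [pow_succ]; exact mul_le_of_le_one_right (by positivity) hδ1

section DBounds

variable {r L n₂ : ℕ} {Θ : ResonanceCutoffs m r L n₂} {b : Fin m} {n₃ : ℕ} {γ : ℝ} {n : ℕ}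

/-- `U₀⁽⁰⁾` as one symbolic polynomial: `D_{>a} - H̃_{>a}^{(0)}`. [cite: DeRoeckHuveneers2015, §5.6 (display for `(H^O_{>a} - H_{>a})^{(0)}`)] -/
def U0zeroPoly (Θ : ResonanceCutoffs m r L n₂) (b : Fin m) (n₃ : ℕ) (γ : ℝ) (n : ℕ) : TrigPoly m :=
  tailD b ++ TrigPoly.neg (hgtPoly Θ b n₃ γ n 0)

/-- `ev U0zeroPoly = U₀⁽⁰⁾`. [folklore] -/
theorem ev_U0zeroPoly (δ : ℝ) (z : PhaseSpace m) : TrigPoly.ev (U0zeroPoly Θ b n₃ γ n) δ z = U0zero Θ b n₃ δ z := by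
  unfold U0zeroPoly U0zero
  rw [TrigPoly.ev_append, TrigPoly.ev_neg, ev_hgtPoly_eq]
  simp only [tailD, normalForm, stage_apply_zero]
  ring

/-- `U0zeroPoly` is of order `0`. [folklore] -/
theorem U0zeroPoly_inClass : (U0zeroPoly Θ b n₃ γ n).InClass 0 := by
  unfold U0zeroPoly
  have h := hgtSeries_inClass (Θ := Θ) (b := b) (n₃ := n₃) (γ := γ) (n := n) 0 (Nat.zero_le n)
  simp only [hgtSeries, mul_zero] at h
  exact ((kinPoly_inClass m).filter _).append h.neg

/-- **Bound on `∂U₀`**: `|∂_{q_y} U₀|, |∂_{ω_y} U₀| ≤ K (𝟙_{Z₁}(ω) δ^{-1} + ∑_{j=1}^n ε^j δ^{-(2j+1)}) W^M`.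
[cite: DeRoeckHuveneers2015, §5.6 ("since `∂_♯ ϑ_{a,x}, ∂_♯ ϑ_{a,*} ∼ δ^{-1}`, we have `⟨(∂_♯(H^O_{>a} - H_{>a})^{(0)})²⟩_T ≤ … ≤ C δ/δ²`" and "`⟨(ε^n ∂_♯(H^O_{>a} - H_{>a})^{(n)})²⟩_T ≤ C (ε^n δ^{-(2n+1)})²`")] -/
theorem dU0_bound (hn : 1 ≤ n) : ∃ K : ℝ, ∃ M : ℕ, 0 ≤ K ∧ ∀ δ : ℝ, 0 < δ → δ ≤ 1 → ∀ ε : ℝ, 0 ≤ ε → ε ≤ 1 →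
    ∀ {R₁ : ℕ}, n₃ + Θ.RS ≤ R₁ → ∀ (y : Fin m) (z : PhaseSpace m),
      |partialQ y (U0 Θ b n₃ γ n ε δ) z| ≤ K * ((Z1set m r b R₁ ((L : ℝ) ^ (n₂ + 1) * δ)).indicator (fun _ => (1 : ℝ)) z.2 / δ +
        ∑ j ∈ Finset.Ico 1 (n + 1), ε ^ j / δ ^ (2 * j + 1)) * (1 + ‖z.2‖) ^ M ∧
      |partialP y (U0 Θ b n₃ γ n ε δ) z| ≤ K * ((Z1set m r b R₁ ((L : ℝ) ^ (n₂ + 1) * δ)).indicator (fun _ => (1 : ℝ)) z.2 / δ +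
        ∑ j ∈ Finset.Ico 1 (n + 1), ε ^ j / δ ^ (2 * j + 1)) * (1 + ‖z.2‖) ^ M := by
  obtain ⟨B0, hB0⟩ := exists_modeBound (U0zeroPoly Θ b n₃ γ n)
  obtain ⟨C0q, M0q, hC0q, h0q'⟩ := (U0zeroPoly_inClass (Θ := Θ) (b := b) (n₃ := n₃) (γ := γ) (n := n)).exists_bound_partialQ hB0
  obtain ⟨C0p, M0p, hC0p, h0p'⟩ := (U0zeroPoly_inClass (Θ := Θ) (b := b) (n₃ := n₃) (γ := γ) (n := n)).exists_bound_partialP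
  obtain ⟨BV, hBV⟩ := exists_modeBound (tailV (m := m) b γ)
  have hVcl : (tailV (m := m) b γ).InClass 0 := (potPoly_inClass m γ).filter _
  obtain ⟨CVq, MVq, hCVq, hVq⟩ := hVcl.exists_bound_partialQ hBV
  obtain ⟨CVp, MVp, hCVp, hVp⟩ := hVcl.exists_bound_partialP
  obtain ⟨CR, MR, hCR, hR⟩ := exists_uniform_bound_partial (RhgtSym Θ b n₃ γ n) (fun j => 2 * j) n RhgtSym_inClass
  set Mx : ℕ := (M0q ⊔ M0p) ⊔ (MVq ⊔ MVp) ⊔ MR with hMx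
  set Kx : ℝ := (C0q + C0p) + (CVq + CVp) + CR with hKx
  refine ⟨Kx, Mx, by positivity, fun δ hδ hδ1 ε hε hε1 R₁ hR₁ y z => ?_⟩
  set W : ℝ := 1 + ‖z.2‖ with hW
  set χ : ℝ := (Z1set m r b R₁ ((L : ℝ) ^ (n₂ + 1) * δ)).indicator (fun _ => (1 : ℝ)) z.2 with hχ
  set S : ℝ := ∑ j ∈ Finset.Ico 1 (n + 1), ε ^ j / δ ^ (2 * j + 1) with hS
  have hW1 : 1 ≤ W := one_le_weight z.2
  have hWge : ∀ {M'}, M' ≤ Mx → W ^ M' ≤ W ^ Mx := fun h => pow_le_pow_right₀ hW1 h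
  have hWx : 0 ≤ W ^ Mx := by positivity
  have hS0 : 0 ≤ S := scaleSum_nonneg _ hε hδ _
  have hεS : ε / δ ≤ S := eps_div_le_scaleSum hn hε hδ hδ1
  have hχ0 : 0 ≤ χ := Set.indicator_nonneg (fun _ _ => zero_le_one) _
  -- differentiability and the decomposition as functions
  have hVd : Differentiable ℝ (TrigPoly.ev (tailV (m := m) b γ) δ) := TrigPoly.differentiable_ev _ fun t ht => (hVcl.smoothAt hδ hδ1 t ht).differentiable
  have hRd : ∀ j ∈ Finset.Ico 1 (n + 1), Differentiable ℝ (fun z => ε ^ j * TrigPoly.ev (RhgtSym Θ b n₃ γ n j) δ z) := by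
    intro j hj
    have hjn : j ≤ n := by have := Finset.mem_Ico.1 hj; omega
    exact (TrigPoly.differentiable_ev _ fun t ht => (((RhgtSym_inClass (Θ := Θ) (b := b) (n₃ := n₃) (γ := γ) (n := n) j hjn).smoothAt hδ hδ1) t ht).differentiable).const_mul _
  have eZ : U0zero Θ b n₃ δ = TrigPoly.ev (U0zeroPoly Θ b n₃ γ n) δ := funext fun z => (ev_U0zeroPoly δ z).symm
  have hZd : Differentiable ℝ (U0zero Θ b n₃ δ) := by
    rw [eZ]; exact TrigPoly.differentiable_ev _ fun t ht => ((U0zeroPoly_inClass (Θ := Θ) (b := b) (n₃ := n₃) (γ := γ) (n := n)).smoothAt hδ hδ1 t ht).differentiable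
  have eU : U0 Θ b n₃ γ n ε δ = (U0zero Θ b n₃ δ + fun z => ε * TrigPoly.ev (tailV b γ) δ z) +
      fun z => (-1 : ℝ) * ∑ j ∈ Finset.Ico 1 (n + 1), ε ^ j * TrigPoly.ev (RhgtSym Θ b n₃ γ n j) δ z := by
    funext z; rw [U0_decomp hδ hδ1]; simp; ring
  have hsumd : Differentiable ℝ (fun z => ∑ j ∈ Finset.Ico 1 (n + 1), ε ^ j * TrigPoly.ev (RhgtSym Θ b n₃ γ n j) δ z) :=
    Differentiable.fun_sum fun j hj => hRd j hj
  have hsumd' : Differentiable ℝ (fun z => (-1 : ℝ) * ∑ j ∈ Finset.Ico 1 (n + 1), ε ^ j * TrigPoly.ev (RhgtSym Θ b n₃ γ n j) δ z) :=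
    hsumd.const_mul (-1)
  have hVd' : Differentiable ℝ (fun z => ε * TrigPoly.ev (tailV b γ) δ z) := hVd.const_mul ε
  -- `|∂ U0zero| ≤ χ (C0q + C0p)/δ W^Mx`
  have hopen : IsOpen {z' : PhaseSpace m | z'.2 ∉ Z1set m r b R₁ ((L : ℝ) ^ (n₂ + 1) * δ)} :=
    (isClosed_Z1set m r b R₁ _).isOpen_compl.preimage continuous_snd
  have h0 : |partialQ y (U0zero Θ b n₃ δ) z| ≤ χ * (C0q + C0p) / δ * W ^ Mx ∧ |partialP y (U0zero Θ b n₃ δ) z| ≤ χ * (C0q + C0p) / δ * W ^ Mx := by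
    by_cases hz : z.2 ∈ Z1set m r b R₁ ((L : ℝ) ^ (n₂ + 1) * δ)
    · have hχ1 : χ = 1 := Set.indicator_of_mem hz _
      rw [hχ1, one_mul, eZ]
      have hq := h0q' δ hδ hδ1 y z
      have hp := h0p' δ hδ hδ1 y z
      rw [pow_zero, div_one] at hq
      rw [zero_add, pow_one] at hp
      constructor
      · refine hq.trans ?_
        have h1 : C0q ≤ (C0q + C0p) / δ := by
          rw [le_div_iff₀ hδ]; nlinarith [mul_le_of_le_one_right hC0q hδ1]
        exact mul_le_mul h1 (hWge (le_sup_left.trans (le_sup_left.trans le_sup_left))) (by positivity) (by positivity)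
      · refine hp.trans ?_
        exact mul_le_mul (div_le_div_of_nonneg_right (by linarith) hδ.le) (hWge (le_sup_right.trans (le_sup_left.trans le_sup_left)))
          (by positivity) (by positivity)
    · have hev : U0zero Θ b n₃ δ =ᶠ[𝓝 z] fun _ => 0 := by
        filter_upwards [hopen.mem_nhds hz] with z' hz'
        exact U0zero_eq_zero hδ hδ1 hR₁ hz'
      rw [partialQ_eq_zero_of_eventuallyEq hev, partialP_eq_zero_of_eventuallyEq hev, abs_zero]
      exact ⟨by positivity, by positivity⟩
  -- `|∂ (ε tailV)| ≤ (CVq + CVp) S W`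
  have h1 : |partialQ y (fun z => ε * TrigPoly.ev (tailV b γ) δ z) z| ≤ (CVq + CVp) * S * W ^ Mx ∧
      |partialP y (fun z => ε * TrigPoly.ev (tailV b γ) δ z) z| ≤ (CVq + CVp) * S * W ^ Mx := by
    rw [show (fun z => ε * TrigPoly.ev (tailV b γ) δ z) = fun z => ε * (TrigPoly.ev (tailV b γ) δ) z from rfl, partialQ_const_mul,
      partialP_const_mul, abs_mul, abs_mul, abs_of_nonneg hε]
    have hq := hVq δ hδ hδ1 y z
    have hp := hVp δ hδ hδ1 y z
    rw [pow_zero, div_one] at hq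
    rw [zero_add, pow_one] at hp
    have hεδ : ε ≤ ε / δ := by rw [le_div_iff₀ hδ]; exact mul_le_of_le_one_right hε hδ1
    constructor
    · calc ε * |partialQ y (TrigPoly.ev (tailV b γ) δ) z| ≤ (ε / δ) * ((CVq + CVp) * W ^ Mx) :=
            mul_le_mul hεδ (hq.trans (mul_le_mul (by linarith) (hWge (le_sup_left.trans (le_sup_right.trans le_sup_left))) (by positivity) (by positivity)))
              (abs_nonneg _) (by positivity)
        _ ≤ S * ((CVq + CVp) * W ^ Mx) := mul_le_mul_of_nonneg_right hεS (by positivity)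
        _ = (CVq + CVp) * S * W ^ Mx := by ring
    · calc ε * |partialP y (TrigPoly.ev (tailV b γ) δ) z| ≤ ε * ((CVq + CVp) / δ * W ^ Mx) :=
            mul_le_mul_of_nonneg_left (hp.trans (mul_le_mul (div_le_div_of_nonneg_right (by linarith) hδ.le)
              (hWge (le_sup_right.trans (le_sup_right.trans le_sup_left))) (by positivity) (by positivity))) hε
        _ = (ε / δ) * ((CVq + CVp) * W ^ Mx) := by ring
        _ ≤ S * ((CVq + CVp) * W ^ Mx) := mul_le_mul_of_nonneg_right hεS (by positivity)
        _ = (CVq + CVp) * S * W ^ Mx := by ring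
  -- `|∂ (-Σ ε^j Rhgt_j)| ≤ CR S W`
  have h2 : |partialQ y (fun z => (-1 : ℝ) * ∑ j ∈ Finset.Ico 1 (n + 1), ε ^ j * TrigPoly.ev (RhgtSym Θ b n₃ γ n j) δ z) z| ≤ CR * S * W ^ Mx ∧
      |partialP y (fun z => (-1 : ℝ) * ∑ j ∈ Finset.Ico 1 (n + 1), ε ^ j * TrigPoly.ev (RhgtSym Θ b n₃ γ n j) δ z) z| ≤ CR * S * W ^ Mx := by
    rw [show (fun z => (-1 : ℝ) * ∑ j ∈ Finset.Ico 1 (n + 1), ε ^ j * TrigPoly.ev (RhgtSym Θ b n₃ γ n j) δ z) =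
        fun z => (-1 : ℝ) * (fun z => ∑ j ∈ Finset.Ico 1 (n + 1), ε ^ j * TrigPoly.ev (RhgtSym Θ b n₃ γ n j) δ z) z from rfl,
      partialQ_const_mul, partialP_const_mul, abs_mul, abs_mul, abs_neg, abs_one, one_mul, one_mul,
      partialQ_finsum _ hRd, partialP_finsum _ hRd]
    have hterm : ∀ j ∈ Finset.Ico 1 (n + 1),
        |partialQ y (fun z => ε ^ j * TrigPoly.ev (RhgtSym Θ b n₃ γ n j) δ z) z| ≤ ε ^ j * (CR / δ ^ (2 * j + 1) * W ^ Mx) ∧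
        |partialP y (fun z => ε ^ j * TrigPoly.ev (RhgtSym Θ b n₃ γ n j) δ z) z| ≤ ε ^ j * (CR / δ ^ (2 * j + 1) * W ^ Mx) := by
      intro j hj
      have hjn : j ≤ n := by have := Finset.mem_Ico.1 hj; omega
      obtain ⟨hq, hp⟩ := hR δ hδ hδ1 j hjn y z
      rw [show (fun z => ε ^ j * TrigPoly.ev (RhgtSym Θ b n₃ γ n j) δ z) = fun z => ε ^ j * (TrigPoly.ev (RhgtSym Θ b n₃ γ n j) δ) z from rfl,
        partialQ_const_mul, partialP_const_mul, abs_mul, abs_mul, abs_of_nonneg (pow_nonneg hε j)]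
      exact ⟨mul_le_mul_of_nonneg_left (hq.trans (mul_le_mul (div_pow_le_div_pow_succ hCR hδ hδ1 _) (hWge le_sup_right) (by positivity) (by positivity))) (pow_nonneg hε j),
        mul_le_mul_of_nonneg_left (hp.trans (mul_le_mul_of_nonneg_left (hWge le_sup_right) (by positivity))) (pow_nonneg hε j)⟩
    have hsum : ∀ (g : ℕ → ℝ), (∀ j ∈ Finset.Ico 1 (n + 1), |g j| ≤ ε ^ j * (CR / δ ^ (2 * j + 1) * W ^ Mx)) →
        |∑ j ∈ Finset.Ico 1 (n + 1), g j| ≤ CR * S * W ^ Mx := by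
      intro g hg
      calc |∑ j ∈ Finset.Ico 1 (n + 1), g j| ≤ ∑ j ∈ Finset.Ico 1 (n + 1), |g j| := Finset.abs_sum_le_sum_abs _ _
        _ ≤ ∑ j ∈ Finset.Ico 1 (n + 1), ε ^ j * (CR / δ ^ (2 * j + 1) * W ^ Mx) := Finset.sum_le_sum hg
        _ = CR * S * W ^ Mx := by
            rw [hS, Finset.mul_sum, Finset.sum_mul]
            exact Finset.sum_congr rfl fun j _ => by ring
    exact ⟨hsum _ fun j hj => (hterm j hj).1, hsum _ fun j hj => (hterm j hj).2⟩
  -- assemble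
  have hfinal : ∀ D0 D1 D2 : ℝ, |D0| ≤ χ * (C0q + C0p) / δ * W ^ Mx → |D1| ≤ (CVq + CVp) * S * W ^ Mx → |D2| ≤ CR * S * W ^ Mx →
      |D0 + D1 + D2| ≤ Kx * (χ / δ + S) * W ^ Mx := by
    intro D0 D1 D2 hD0 hD1 hD2
    have hχδ : 0 ≤ χ / δ := div_nonneg hχ0 hδ.le
    have hK1 : C0q + C0p ≤ Kx := by rw [hKx]; linarith
    have hK2 : (CVq + CVp) + CR ≤ Kx := by rw [hKx]; linarith
    calc |D0 + D1 + D2| ≤ |D0| + |D1| + |D2| := by linarith [abs_add_le (D0 + D1) D2, abs_add_le D0 D1]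
      _ ≤ χ * (C0q + C0p) / δ * W ^ Mx + (CVq + CVp) * S * W ^ Mx + CR * S * W ^ Mx := by linarith
      _ = (χ / δ * (C0q + C0p) + ((CVq + CVp) + CR) * S) * W ^ Mx := by ring
      _ ≤ (χ / δ * Kx + Kx * S) * W ^ Mx := by gcongr
      _ = Kx * (χ / δ + S) * W ^ Mx := by ring
  rw [eU, partialQ_add (hZd.add hVd') hsumd', partialQ_add hZd hVd', partialP_add (hZd.add hVd') hsumd', partialP_add hZd hVd']
  exact ⟨hfinal _ _ _ h0.1 h1.1 h2.1, hfinal _ _ _ h0.2 h1.2 h2.2⟩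

end DBounds

/-! ### Bounds on `A` and `B` -/

section GBounds

variable {r L n₂ : ℕ} {Θ : ResonanceCutoffs m r L n₂} {b : Fin m} {n₃ : ℕ} {γ : ℝ} {n : ℕ}

/-- **Bounds on `A`**: `A` and its gradient vanish off `Z`, and everywhere
`|A| ≤ 𝟙_Z K (∑_{l=0}^n ε^l δ^{-(2l+1)}) W^M`, `|∂A| ≤ 𝟙_Z K (∑_l ε^l δ^{-(2l+2)}) W^M`.
[cite: DeRoeckHuveneers2015, §5.6 ("the function `L_H̃ H̃_{>a}` vanishes on the open set `Ω ∖ Z`, so that `∂_♯ 𝒯_{n₁}(R L_H̃ H̃_{>a})` vanishes on this set as well"; "`∂_♯ 𝒯_{n₁}(R L_H̃ H̃_{>a}) ∼ ∑_{k=0}^{n₁} ε^k δ^{-(2+2k)}`")] -/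
theorem Aterm_bound (hr : IsSchemeRadius n r) (hroom : HasRoom Θ.RS n₂ b n₃) :
    ∃ K : ℝ, ∃ M : ℕ, 0 ≤ K ∧ ∀ δ : ℝ, 0 < δ → δ ≤ 1 → ∀ ε : ℝ, 0 ≤ ε → ε ≤ 1 →
      ∀ {Rz : ℕ}, n₃ + Θ.RS ≤ Rz → ∀ (y : Fin m) (z : PhaseSpace m),
        |Aterm Θ b n₃ γ n ε δ z| ≤ (Zset m r n₂ b Rz ((L : ℝ) ^ (n₂ + 1) * δ)).indicator (fun _ => (1 : ℝ)) z.2 * K *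
            (∑ l ∈ Finset.range (n + 1), ε ^ l / δ ^ (2 * l + 1)) * (1 + ‖z.2‖) ^ M ∧
        |partialQ y (Aterm Θ b n₃ γ n ε δ) z| ≤ (Zset m r n₂ b Rz ((L : ℝ) ^ (n₂ + 1) * δ)).indicator (fun _ => (1 : ℝ)) z.2 * K *
            (∑ l ∈ Finset.range (n + 1), ε ^ l / δ ^ (2 * l + 2)) * (1 + ‖z.2‖) ^ M ∧
        |partialP y (Aterm Θ b n₃ γ n ε δ) z| ≤ (Zset m r n₂ b Rz ((L : ℝ) ^ (n₂ + 1) * δ)).indicator (fun _ => (1 : ℝ)) z.2 * K *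
            (∑ l ∈ Finset.range (n + 1), ε ^ l / δ ^ (2 * l + 2)) * (1 + ‖z.2‖) ^ M := by
  obtain ⟨C, M, hC, hb⟩ := exists_uniform_bound_ev (RXsym Θ b n₃ γ n) (fun l => 2 * l + 1) n RXsym_inClass
  obtain ⟨C', M', hC', hb'⟩ := exists_uniform_bound_partial (RXsym Θ b n₃ γ n) (fun l => 2 * l + 1) n RXsym_inClass
  refine ⟨C + C', M ⊔ M', by positivity, fun δ hδ hδ1 ε hε hε1 Rz hRz y z => ?_⟩
  set W : ℝ := 1 + ‖z.2‖ with hW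
  set χ : ℝ := (Zset m r n₂ b Rz ((L : ℝ) ^ (n₂ + 1) * δ)).indicator (fun _ => (1 : ℝ)) z.2 with hχ
  have hW1 : 1 ≤ W := one_le_weight z.2
  have hWM : W ^ M ≤ W ^ (M ⊔ M') := pow_le_pow_right₀ hW1 le_sup_left
  have hWM' : W ^ M' ≤ W ^ (M ⊔ M') := pow_le_pow_right₀ hW1 le_sup_right
  have hWx : 0 ≤ W ^ (M ⊔ M') := by positivity
  have eA : Aterm Θ b n₃ γ n ε δ = fun z => ∑ l ∈ Finset.range (n + 1), ε ^ l * TrigPoly.ev (RXsym Θ b n₃ γ n l) δ z :=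
    funext fun z => Aterm_eq_sum hδ hδ1 ε z
  have hRd : ∀ l ∈ Finset.range (n + 1), Differentiable ℝ (fun z => ε ^ l * TrigPoly.ev (RXsym Θ b n₃ γ n l) δ z) := by
    intro l hl
    have hln : l ≤ n := Nat.lt_succ_iff.1 (Finset.mem_range.1 hl)
    exact (TrigPoly.differentiable_ev _ fun t ht => (((RXsym_inClass (Θ := Θ) (b := b) (n₃ := n₃) (γ := γ) (n := n) l hln).smoothAt hδ hδ1) t ht).differentiable).const_mul _
  by_cases hz : z.2 ∈ Zset m r n₂ b Rz ((L : ℝ) ^ (n₂ + 1) * δ)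
  · have hχ1 : χ = 1 := Set.indicator_of_mem hz _
    rw [hχ1]
    simp only [one_mul]
    refine ⟨?_, ?_, ?_⟩
    · rw [Aterm_eq_sum hδ hδ1]
      calc |∑ l ∈ Finset.range (n + 1), ε ^ l * TrigPoly.ev (RXsym Θ b n₃ γ n l) δ z|
          ≤ ∑ l ∈ Finset.range (n + 1), |ε ^ l * TrigPoly.ev (RXsym Θ b n₃ γ n l) δ z| := Finset.abs_sum_le_sum_abs _ _
        _ ≤ ∑ l ∈ Finset.range (n + 1), ε ^ l * ((C + C') / δ ^ (2 * l + 1) * W ^ (M ⊔ M')) := by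
            refine Finset.sum_le_sum fun l hl => ?_
            have hln : l ≤ n := Nat.lt_succ_iff.1 (Finset.mem_range.1 hl)
            rw [abs_mul, abs_of_nonneg (pow_nonneg hε l)]
            exact mul_le_mul_of_nonneg_left ((hb δ hδ hδ1 l hln z).trans
              (mul_le_mul (div_le_div_of_nonneg_right (by linarith) (by positivity)) hWM (by positivity) (by positivity))) (pow_nonneg hε l)
        _ = (C + C') * (∑ l ∈ Finset.range (n + 1), ε ^ l / δ ^ (2 * l + 1)) * W ^ (M ⊔ M') := by
            rw [Finset.mul_sum, Finset.sum_mul]; exact Finset.sum_congr rfl fun l _ => by ring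
    · rw [eA, partialQ_finsum _ hRd]
      calc |∑ l ∈ Finset.range (n + 1), partialQ y (fun z => ε ^ l * TrigPoly.ev (RXsym Θ b n₃ γ n l) δ z) z|
          ≤ ∑ l ∈ Finset.range (n + 1), |partialQ y (fun z => ε ^ l * TrigPoly.ev (RXsym Θ b n₃ γ n l) δ z) z| := Finset.abs_sum_le_sum_abs _ _
        _ ≤ ∑ l ∈ Finset.range (n + 1), ε ^ l * ((C + C') / δ ^ (2 * l + 2) * W ^ (M ⊔ M')) := by
            refine Finset.sum_le_sum fun l hl => ?_
            have hln : l ≤ n := Nat.lt_succ_iff.1 (Finset.mem_range.1 hl)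
            rw [show (fun z => ε ^ l * TrigPoly.ev (RXsym Θ b n₃ γ n l) δ z) = fun z => ε ^ l * (TrigPoly.ev (RXsym Θ b n₃ γ n l) δ) z from rfl,
              partialQ_const_mul, abs_mul, abs_of_nonneg (pow_nonneg hε l)]
            refine mul_le_mul_of_nonneg_left (((hb' δ hδ hδ1 l hln y z).1).trans ?_) (pow_nonneg hε l)
            exact mul_le_mul ((div_le_div_of_nonneg_right (by linarith) (by positivity)).trans (div_pow_le_div_pow_succ (by positivity) hδ hδ1 _))
              hWM' (by positivity) (by positivity)
        _ = (C + C') * (∑ l ∈ Finset.range (n + 1), ε ^ l / δ ^ (2 * l + 2)) * W ^ (M ⊔ M') := by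
            rw [Finset.mul_sum, Finset.sum_mul]; exact Finset.sum_congr rfl fun l _ => by ring
    · rw [eA, partialP_finsum _ hRd]
      calc |∑ l ∈ Finset.range (n + 1), partialP y (fun z => ε ^ l * TrigPoly.ev (RXsym Θ b n₃ γ n l) δ z) z|
          ≤ ∑ l ∈ Finset.range (n + 1), |partialP y (fun z => ε ^ l * TrigPoly.ev (RXsym Θ b n₃ γ n l) δ z) z| := Finset.abs_sum_le_sum_abs _ _
        _ ≤ ∑ l ∈ Finset.range (n + 1), ε ^ l * ((C + C') / δ ^ (2 * l + 2) * W ^ (M ⊔ M')) := by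
            refine Finset.sum_le_sum fun l hl => ?_
            have hln : l ≤ n := Nat.lt_succ_iff.1 (Finset.mem_range.1 hl)
            rw [show (fun z => ε ^ l * TrigPoly.ev (RXsym Θ b n₃ γ n l) δ z) = fun z => ε ^ l * (TrigPoly.ev (RXsym Θ b n₃ γ n l) δ) z from rfl,
              partialP_const_mul, abs_mul, abs_of_nonneg (pow_nonneg hε l)]
            refine mul_le_mul_of_nonneg_left (((hb' δ hδ hδ1 l hln y z).2).trans ?_) (pow_nonneg hε l)
            exact mul_le_mul (div_le_div_of_nonneg_right (by linarith) (by positivity)) hWM' (by positivity) (by positivity)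
        _ = (C + C') * (∑ l ∈ Finset.range (n + 1), ε ^ l / δ ^ (2 * l + 2)) * W ^ (M ⊔ M') := by
            rw [Finset.mul_sum, Finset.sum_mul]; exact Finset.sum_congr rfl fun l _ => by ring
  · have hχ0 : χ = 0 := Set.indicator_of_notMem hz _
    have hev : Aterm Θ b n₃ γ n ε δ =ᶠ[𝓝 z] fun _ => 0 := by
      have hopen : IsOpen {z' : PhaseSpace m | z'.2 ∉ Zset m r n₂ b Rz ((L : ℝ) ^ (n₂ + 1) * δ)} :=
        (isClosed_Zset m r n₂ b Rz _).isOpen_compl.preimage continuous_snd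
      filter_upwards [hopen.mem_nhds hz] with z' hz'
      exact Aterm_eq_zero_of_not_mem_Zset hδ hδ1 hr hroom hRz ε hz'
    rw [hχ0, Aterm_eq_zero_of_not_mem_Zset hδ hδ1 hr hroom hRz ε hz, partialQ_eq_zero_of_eventuallyEq hev,
      partialP_eq_zero_of_eventuallyEq hev, abs_zero]
    simp

/-- **Bounds on `B`**: `|B| ≤ K δ^{-(2n+1)} W^M`, `|∂B| ≤ K δ^{-(2n+2)} W^M`. [cite: DeRoeckHuveneers2015, §5.6 ("`∂_♯ L_V ∑_{k=0}^{n₁} R^{(n₁-k)} H̃^{(k)}_{>a} ∼ δ^{-2n₁-2}`")] -/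
theorem Bterm_bound : ∃ K : ℝ, ∃ M : ℕ, 0 ≤ K ∧ ∀ δ : ℝ, 0 < δ → δ ≤ 1 → ∀ (y : Fin m) (z : PhaseSpace m),
    |Bterm Θ b n₃ γ n δ z| ≤ K / δ ^ (2 * n + 1) * (1 + ‖z.2‖) ^ M ∧
      |partialQ y (Bterm Θ b n₃ γ n δ) z| ≤ K / δ ^ (2 * n + 2) * (1 + ‖z.2‖) ^ M ∧
      |partialP y (Bterm Θ b n₃ γ n δ) z| ≤ K / δ ^ (2 * n + 2) * (1 + ‖z.2‖) ^ M := by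
  have hcl := Bsym_inClass (Θ := Θ) (b := b) (n₃ := n₃) (γ := γ) (n := n)
  obtain ⟨B0, hB0⟩ := exists_modeBound (Bsym Θ b n₃ γ n)
  obtain ⟨C, M, hC, hb⟩ := hcl.exists_bound_ev
  obtain ⟨Cq, Mq, hCq, hq⟩ := hcl.exists_bound_partialQ hB0
  obtain ⟨Cp, Mp, hCp, hp⟩ := hcl.exists_bound_partialP
  refine ⟨C + Cq + Cp, M ⊔ Mq ⊔ Mp, by positivity, fun δ hδ hδ1 y z => ?_⟩
  have hW1 : 1 ≤ 1 + ‖z.2‖ := one_le_weight z.2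
  have e : Bterm Θ b n₃ γ n δ = TrigPoly.ev (Bsym Θ b n₃ γ n) δ := funext fun z => Bterm_eq_ev hδ hδ1 z
  rw [e]
  refine ⟨(hb δ hδ hδ1 z).trans ?_, (hq δ hδ hδ1 y z).trans ?_, (hp δ hδ hδ1 y z).trans ?_⟩
  · exact mul_le_mul (div_le_div_of_nonneg_right (by linarith) (by positivity)) (pow_le_pow_right₀ hW1 (le_sup_left.trans le_sup_left))
      (by positivity) (by positivity)
  · exact mul_le_mul ((div_le_div_of_nonneg_right (by linarith) (by positivity)).trans (div_pow_le_div_pow_succ (by positivity) hδ hδ1 _))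
      (pow_le_pow_right₀ hW1 (le_sup_right.trans le_sup_left)) (by positivity) (by positivity)
  · exact mul_le_mul (div_le_div_of_nonneg_right (by linarith) (by positivity)) (pow_le_pow_right₀ hW1 le_sup_right)
      (by positivity) (by positivity)

end GBounds

end Literature.Barriers.AtomisticToContinuum.HeatConduction.RotorChain

end
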